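/-
Copyright: cell pub-balaban-gaps (YM BLITZ Y1, track G1), seat g1-p2 GEN 5 (unit `pub-balaban-gaps-g1-p2`).  Row (D4) NODE O,
OBJECT ∕ MECHANISM level: THE JUNCTION J-2 OF THE TWO SUPPLY CHAINS (g1-plan-1 ROUTES-PLAN-1 §2 note 26 (b2)∕(c)): the prior
programme's CONSTRUCTED operator — the k-fold covariant tower MODEL `Δ′ = Δ_U + Σ_{l≤k} a_l·G_lᵀG_l` of the pv21 model of [B9]
on every torus, every isometric bond transport `U` (unit `b2b-balaban-beta-d4-p2`, `Beta/CovariantTower*`, 2026-08-20), with its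
LETTERS PROVED there (b05 partition `hTorus`: Σh² = 1, |h| ≤ 1, Lipschitz 4d∕M₀, supports `ETorus`; Dirichlet local inverses
`LTorus` with `Pj_mul_LTorus`, `local_inverse_LTorus` and the Combes–Thomas budget `wrs_LTorus`; finite range `rangeTower` and
ℓ² bound `towerLambda` of `Δ′`) — FED INTO this cell's PACKAGING (`D4WalkBlockCommutator.blockWalkExpansion_parametrix_lipschitz`):
the glued parametrix `Ptot·(1 − Rem)⁻¹` of `Δ′` IS a `BlockWalkExpansion` (this cell's NODE-O object in block currency) with
EXPLICIT constants depending on `(d, M, k, a, c, w, |Cp|, M₀)` — NOT on the volume, NOT on `U` —, the Neumann margin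
`O(rangeTower·4d∕M₀)`: «M₀ sufficiently large».
HONEST FRAMING: MODEL level (scalar covariant prototype, k-DEPENDENT constants, σ-free, u-constant); Bałaban's `Δ^{(k)}` ∕ `G̃₀`
(vector side, constraints, print's norms, k-uniformity) NOT touched; (D4) NOT discharged (instance 0∕1); NOT BetaPertH, NOT
continuum, NOT Clay.
-/
import Summits.QuantumFields.BalabanUV.Gaps.D4WalkBlockCommutator
import Summits.QuantumFields.BalabanUV.Beta.CovariantTowerWRS
import Literature.MathematicalPhysics.QuantumFieldTheory.Balaban1983to89.B13LocalKernelWalks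

/-!
# `Gaps.D4WalkBlockCovariantTower` — junction J-2: the prior engine's covariant tower operator in this cell's block walk
packaging (cell pub-balaban-gaps, seat g1-p2 gen 5)

HONEST DEPENDENCY (cell pub-balaban, verbatim): continuum YM on T⁴ ⇐ BetaPertH ∧ nine spine estimates (0/9 proved);
BetaPertH ⇐ (D1) ∧ (D4) ∧ CAP+tail.

Two (2.16)-supply chains coexisted in the tree with no common file (plan-1 note 26 (b4)): PRIOR = letters PROVED for a
CONSTRUCTED covariant model operator, no [B13] packaging; THIS CELL = the packaging (`BlockWalkExpansion` → `JointWalkExpansion`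
→ `TermWalkData` → NODE A) with the letters ASSUMED.  THIS FILE is the first module importing both: it reads the prior engine's
torus data (`CovariantTowerWRS` §1–§2, BY NAME, nothing restated) as the primitive letters of `D4WalkBlockCommutator.
blockWalkExpansion_parametrix_lipschitz` — sites `UT N × Cp`, cubes = torus sites (`cubn = Prod.fst`, the finest block
resolution), site pseudo-distance `dTorus`, skeleton `B = Ctr N M₀` (b05 centres) with domains the `dist`-balls of radius
`ρ_dom = (M₀ + 1 + 2S_k) + D_k` around the centres, local inverses `G′_z = LTorus … z` (Dirichlet inverses on the hulls `Ω₀(z)`),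
`K′ = cmat Δ′ − 1`, no σ-parameters (`J = ∅`, `X = ∅`).
* §1 geometry of the torus: `tdist1 ≤ d·dist`, the fibre count of `Prod.fst`, cardinalities of balls and of centres.
* §2 the letters: block bound of `G′_z` from `wrs_LTorus` at rate `0` (`C_L = localConst … 0`), block bound of `K′` from the
  ℓ² bound (`C_K = |Cp|·(Λ_k + 1)`), range `D_k = rangeTower`, partition letters, domain letters.
* §3 **`blockWalkExpansion_covariantTower`**: for every torus (`M_j ∣ N_i`), every isometric `U`, every
  cube row-sum rate `μ > 0` and rates `3μ ≤ ε₀`, `2μ ≤ κ₀`, `κ₀ + μ ≤ ρ₀ − ε₀`, under the margin `q < 1` (letters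
  `λ_K = (D_k∕(M₀∕4d))·C_K`, `C_L`, `n_C`, `n_D = 3^d`, `m_J = 0`, `c_μ = c₀(1,μ)^d`, `r = 2dρ_dom`): the glued parametrix of `Δ′` is a
  `BlockWalkExpansion` on any ball of any configuration space (u-constant), all constants volume-free and U-free.
WHAT IT IS NOT: Bałaban's operators; k-uniform constants ((v)); the s-decoration (σ-free instance: `J = ∅`); the identification of
the glued kernel with `(cmat Δ′)⁻¹` is `D4WalkBlockParametrix.glued_one_eq_inv` + `CovariantTowerRowData.cmat_inverse_towerOp` given
invertibility of `1 − Rem` (supplied by `CovariantTowerWRS.walkInversion_tower_torus` under its WRS smallness) — not restated here;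
(D4) instance 0∕1; words UNCHANGED.
-/

noncomputable section

namespace Summit.QuantumFields.BalabanUV.Gaps.D4WalkBlockCovariantTower

open Metric Set Finset
open Literature.MathematicalPhysics.QuantumFieldTheory.Balaban1983to89
open Literature.MathematicalPhysics.QuantumFieldTheory.Balaban1983to89.B9SectDWalk (DomBy)
open Literature.MathematicalPhysics.QuantumFieldTheory.Balaban1983to89.B9Thm34Ext (toB6)
open Literature.MathematicalPhysics.QuantumFieldTheory.Balaban1983to89.B9Thm37GlueTorus (torusGeom tdist1 tdist1_nonneg)
open Literature.MathematicalPhysics.QuantumFieldTheory.Balaban1983to89.TreeLengthTorus (TPt)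
open Literature.MathematicalPhysics.QuantumFieldTheory.Balaban1983to89.B5TorusCover (UT Ctr ctrU hnu_holds)
open Literature.MathematicalPhysics.QuantumFieldTheory.Balaban1983to89.B11SectG (RowSum)
open Literature.MathematicalPhysics.QuantumFieldTheory.Balaban1983to89.B13PerturbativeStep (WRS wrs)
open Literature.MathematicalPhysics.QuantumFieldTheory.Balaban1983to89.B13DomainKernelWalks (DomainTerms)
open Literature.MathematicalPhysics.QuantumFieldTheory.Balaban1983to89.B13LocalKernelWalks (rowSum_torus)
open Literature.MathematicalPhysics.QuantumFieldTheory.Balaban1983to89.B9Thm37GlueTorusCovTower (towerBlk towerOp torusTower)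
open Summit.QuantumFields.BalabanUV.Beta.CovariantTowerDecay (towerS)
open Summit.QuantumFields.BalabanUV.Gaps.D4WalkBlock (rowMass blockNorm blockNorm_le_of_rowMass_le BlockWalkExpansion)
open Summit.QuantumFields.BalabanUV.Gaps.D4WalkBlockCommutator (blockWalkExpansion_parametrix_lipschitz)
open Summit.QuantumFields.BalabanUV.T4Continuum.Spine.NE5.TwoRunPencilDomains (withOp)
open Summit.QuantumFields.BalabanUV.Beta.UnitLatticeWalkInversion (Hd Pj)
open Summit.QuantumFields.BalabanUV.Beta.CovariantTowerMatrix (cmat cmat_apply norm_cmat_le_of_l2Bound norm_cmat_apply)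
open Summit.QuantumFields.BalabanUV.Beta.CovariantTowerLocal
  (rangeTower one_le_rangeTower rangeTower_nonneg towerLambda l2Bound_towerOp_torus towerOp_single_eq_zero_of_far card_ball_le)
open Summit.QuantumFields.BalabanUV.Beta.CovariantTowerWRS
open Summit.QuantumFields.BalabanUV.Beta.CovariantTowerCover (dist_lt_of_omegaBall_eq_one)

variable {d : ℕ} {N : Fin d → ℕ} [∀ i, NeZero (N i)] [NeZero d]
variable {Cp : Type} [Fintype Cp] [DecidableEq Cp]

/-! ## §1. Torus geometry: `d₁ ≤ d·dist`, fibres of `Prod.fst`, balls, centres -/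

omit [NeZero d] in
/-- The ℓ¹ torus distance is at most `d` times the sup-distance. [folklore] -/
theorem tdist1_le_mul_dist (x y : UT N) : tdist1 N x y ≤ d * dist x y := by
  rw [UT.dist_eq]
  unfold tdist1 B4Sect5Torus.tdist
  have h : ∀ i, ((B4Sect5Torus.ccoord N (UT.toSite N x) (UT.toSite N y) i : ℕ) : ℝ) ≤
      ((Finset.univ.sup (B4Sect5Torus.ccoord N (UT.toSite N x) (UT.toSite N y)) : ℕ) : ℝ) :=
    fun i => by exact_mod_cast Finset.le_sup (f := B4Sect5Torus.ccoord N (UT.toSite N x) (UT.toSite N y)) (Finset.mem_univ i)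
  calc ∑ i, ((B4Sect5Torus.ccoord N (UT.toSite N x) (UT.toSite N y) i : ℕ) : ℝ)
      ≤ ∑ _i : Fin d, ((Finset.univ.sup (B4Sect5Torus.ccoord N (UT.toSite N x) (UT.toSite N y)) : ℕ) : ℝ) :=
        Finset.sum_le_sum fun i _ => h i
    _ = d * _ := by rw [Finset.sum_const, Finset.card_univ, Fintype.card_fin, nsmul_eq_mul]

omit [∀ i, NeZero (N i)] [NeZero d] [DecidableEq Cp] in
/-- The fibre of `Prod.fst` over a torus site has `|Cp|` points. [folklore] -/
theorem card_fibre_fst (y : UT N) : (Finset.univ.filter fun q : UT N × Cp => q.1 = y).card = Fintype.card Cp := by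
  rw [show (Finset.univ.filter fun q : UT N × Cp => q.1 = y) = (Finset.univ : Finset Cp).map ⟨fun c => (y, c),
      fun c c' h => (Prod.mk.inj h).2⟩ from ?_]
  · rw [Finset.card_map, Finset.card_univ]
  · ext q
    simp only [Finset.mem_filter, Finset.mem_univ, true_and, Finset.mem_map, Function.Embedding.coeFn_mk]
    constructor
    · intro h; exact ⟨q.2, by rw [← h]⟩
    · rintro ⟨c, rfl⟩; rfl

omit [∀ i, NeZero (N i)] [NeZero d] [DecidableEq Cp] in
/-- A row mass over a fibre of `Prod.fst` under a uniform entry bound. [folklore] -/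
theorem rowMass_fst_le {T : Matrix (UT N × Cp) (UT N × Cp) ℂ} {B : ℝ} (hB : ∀ p q, ‖T p q‖ ≤ B) (p : UT N × Cp) (y : UT N) :
    rowMass (Prod.fst : UT N × Cp → UT N) T p y ≤ Fintype.card Cp * B := by
  unfold rowMass
  calc ∑ q ∈ Finset.univ.filter (fun q : UT N × Cp => q.1 = y), ‖T p q‖
      ≤ ∑ _q ∈ Finset.univ.filter (fun q : UT N × Cp => q.1 = y), B := Finset.sum_le_sum fun q _ => hB p q
    _ = Fintype.card Cp * B := by rw [Finset.sum_const, card_fibre_fst, nsmul_eq_mul]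

omit [∀ i, NeZero (N i)] [NeZero d] [DecidableEq Cp] in
/-- A row mass over a fibre is below the full row sum. [folklore] -/
theorem rowMass_fst_le_rowSum (T : Matrix (UT N × Cp) (UT N × Cp) ℂ) (p : UT N × Cp) (y : UT N) :
    rowMass (Prod.fst : UT N × Cp → UT N) T p y ≤ ∑ q, ‖T p q‖ :=
  Finset.sum_le_sum_of_subset_of_nonneg (Finset.filter_subset _ _) fun _ _ _ => norm_nonneg _

/-! ## §2. The domain skeleton and its letters -/

/-- MODEL bookkeeping: the domain radius `ρ_dom = (M₀ + 1 + 2S_k) + D_k` (hull radius + range of `Δ′`). -/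
def domRadius (d : ℕ) (M : ℕ → ℕ) (k M₀ : ℕ) : ℝ := ((M₀ : ℝ) + 1 + 2 * (towerS (fun j => d * (M j - 1)) k : ℝ)) + rangeTower d M k

omit [NeZero d] in
/-- `0 ≤ ρ_dom`. [folklore] -/
theorem domRadius_nonneg (d : ℕ) (M : ℕ → ℕ) (k M₀ : ℕ) : 0 ≤ domRadius d M k M₀ := by
  unfold domRadius; exact add_nonneg (by positivity) (rangeTower_nonneg d M k)

/-- MODEL bookkeeping: THE DOMAIN SKELETON of the covariant tower instance — terms = b05 centres `z`, domain = the `dist`-ball of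
radius `ρ_dom` around the centre, anchor = the centre, NO σ-parameters, coefficient = the Dirichlet local inverse `G′_z` (u-constant). -/
def skel {M : ℕ → ℕ} (hM : ∀ j, 1 ≤ M j) (hdiv : ∀ j i, M j ∣ N i) (c : UT N × Fin d → ℝ)
    (Rm : UT N × Fin d → Cp → Cp → ℝ) (k : ℕ) (w : Fin (k + 1) → UT N → ℝ) (a : Fin (k + 1) → ℝ) (M₀ : ℕ)
    (E : Type*) [NormedAddCommGroup E] [NormedSpace ℂ E] (d₀ N' : ℕ) :
    DomainTerms d₀ N' d N (UT N × Cp) (UT N × Cp) E where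
  B := Ctr N M₀
  dom z := Finset.univ.filter fun y : UT N => dist (ctrU N M₀ z) y ≤ domRadius d M k M₀
  anchor z := ctrU N M₀ z
  J _ := ∅
  op z _ := LTorus hM hdiv c Rm k w a M₀ z

/-! ## §3. The glued parametrix of the covariant tower operator is a block walk expansion -/

/-- **JUNCTION J-2: THE PRIOR ENGINE'S COVARIANT TOWER OPERATOR IN THIS CELL'S BLOCK WALK PACKAGING.**  For the k-fold covariant
tower MODEL operator `Δ′` on any torus (`M_j ∣ N_i`; b05 scale `1 ≤ M₀` — `Σ h² = 1` is NOT needed for the expansion itself), any isometric transport, bond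
weights `c_min ≤ |c| ≤ c_max`, site weights `|w| ≤ w_max` with the cover condition, `a_l ≥ 0`: with the b05 partition `{h_z}`, the
Dirichlet local inverses `G′_z` and `K′ = cmat Δ′ − 1`, the glued parametrix `(Σ_z h_zG′_zh_z)·(1 − Σ_z [h_z,K′]G′_zh_z)⁻¹` is a
`BlockWalkExpansion` (cubes = sites, no σ-parameters, any configuration ball, u-constant) at `(ρ₀ − 3μ, ε₀ − 3μ, κ₀ − 2μ)` with
EXPLICIT volume-free, U-free constants, under the Neumann margin `q < 1` whose smallness letter is `λ_K = (D_k∕(M₀∕4d))·|Cp|(Λ_k + 1)`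
— «M₀ sufficiently large» at fixed `(d, M, k, a, c, w, |Cp|)`.  Every letter of `blockWalkExpansion_parametrix_lipschitz` is
DISCHARGED by a theorem of `Beta/CovariantTowerWRS` ∕ `CovariantTowerLocal` ∕ `B5TorusCover` BY NAME.
[cite: Balaban1985BackgroundPropagators, Thm 3.7 (3.87)–(3.90) p.409, Cor 3.8 p.410, Thm 3.10 (3.107)–(3.108) p.416; Balaban1988RG2Cluster, (1.11) p.5] -/
theorem blockWalkExpansion_covariantTower {M : ℕ → ℕ} (hM : ∀ j, 1 ≤ M j) (hdiv : ∀ j i, M j ∣ N i)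
    (c : UT N × Fin d → ℝ) {cmin cmax : ℝ} (hcmin : 0 < cmin) (hc : ∀ b, cmin ≤ |c b|) (hc' : ∀ b, |c b| ≤ cmax)
    (Rm : UT N × Fin d → Cp → Cp → ℝ) (hRm : ∀ b i j, ∑ k, Rm b k i * Rm b k j = if i = j then (1 : ℝ) else 0)
    (k : ℕ) (w : Fin (k + 1) → UT N → ℝ) {wmax : ℝ} (hw' : ∀ l y, |w l y| ≤ wmax) {a : Fin (k + 1) → ℝ}
    (ha : ∀ l, 0 ≤ a l) {amin wmin : ℝ} (hamin : 0 < amin) (hwmin : 0 < wmin)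
    (hcov : ∀ x, ∃ l : Fin (k + 1), amin ≤ a l ∧ wmin ≤ |w l (towerBlk (torusTower hM hdiv) (l : ℕ) x)|)
    {M₀ : ℕ} (hM₀ : 1 ≤ M₀)
    (E : Type*) [NormedAddCommGroup E] [NormedSpace ℂ E] (d₀ N' : ℕ) (c₀ : B13.Consts) (hκ₁ : 0 ≤ c₀.κ₁) {R : ℝ}
    {ρ₀ ε₀ κ₀ μ : ℝ} (hμ : 0 < μ) (hμε : 3 * μ ≤ ε₀) (hμκ : 2 * μ ≤ κ₀) (hwin : κ₀ + μ ≤ ρ₀ - ε₀)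
    (hq : B6.c0 1 μ ^ d * (B6.c0 1 μ ^ d * 1 *
      (1 * (((⌈(2 * domRadius d M k M₀ + 1) ^ d⌉₊ *
          (rangeTower d M k / ((M₀ : ℝ) / (4 * d)) * (Fintype.card Cp * (towerLambda d M cmax wmax k a + 1))) *
          localConst d M amin wmin cmin cmax wmax k a (Fintype.card Cp) 0) *
        Real.exp (c₀.κ₁ * (0 : ℕ)) * Real.exp (2 * ρ₀ * (d * (2 * domRadius d M k M₀)))) *
        Real.exp (μ * (d * (2 * domRadius d M k M₀))) * ((3 ^ d : ℕ) * B6.c0 1 μ ^ d))) * B6.c0 1 μ ^ d) *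
      B6.c0 1 μ ^ d < 1) :
    ∃ (W : Type) (T : W → (TPt d₀ N' → ℂ) → E → Matrix (UT N × Cp) (UT N × Cp) ℂ) (SX : Set W) (A : W → ℝ)
      (D : W → UT N → UT N → ℝ) (ρ' : ℝ),
      BlockWalkExpansion c₀ (Prod.fst : UT N × Cp → UT N) Prod.fst
        (fun σ₀ u =>
          (withOp (skel hM hdiv c Rm k w a M₀ E d₀ N') fun z _ =>
              Hd (hTorus N Cp M₀) z * LTorus hM hdiv c Rm k w a M₀ z * Hd (hTorus N Cp M₀) z).kernel σ₀ u *
            ((1 : Matrix (UT N × Cp) (UT N × Cp) ℂ) + (-1 : ℂ) •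
              (withOp (skel hM hdiv c Rm k w a M₀ E d₀ N') fun z _ =>
                (Hd (hTorus N Cp M₀) z * (cmat (towerOpT hM hdiv c Rm k w a) - 1) -
                    (cmat (towerOpT hM hdiv c Rm k w a) - 1) * Hd (hTorus N Cp M₀) z) *
                  LTorus hM hdiv c Rm k w a M₀ z * Hd (hTorus N Cp M₀) z).kernel σ₀ u)⁻¹)
        ∅ R (ε₀ - 3 * μ) (κ₀ - 2 * μ)
        (B6.c0 1 μ ^ d * ((localConst d M amin wmin cmin cmax wmax k a (Fintype.card Cp) 0 * Real.exp (c₀.κ₁ * (0 : ℕ)) *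
            Real.exp (2 * ρ₀ * (d * (2 * domRadius d M k M₀)))) * Real.exp (μ * (d * (2 * domRadius d M k M₀))) *
            ((3 ^ d : ℕ) * B6.c0 1 μ ^ d)) *
          (1 * (1 - B6.c0 1 μ ^ d * (B6.c0 1 μ ^ d * 1 *
            (1 * (((⌈(2 * domRadius d M k M₀ + 1) ^ d⌉₊ *
                (rangeTower d M k / ((M₀ : ℝ) / (4 * d)) * (Fintype.card Cp * (towerLambda d M cmax wmax k a + 1))) *
                localConst d M amin wmin cmin cmax wmax k a (Fintype.card Cp) 0) *
              Real.exp (c₀.κ₁ * (0 : ℕ)) * Real.exp (2 * ρ₀ * (d * (2 * domRadius d M k M₀)))) *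
              Real.exp (μ * (d * (2 * domRadius d M k M₀))) * ((3 ^ d : ℕ) * B6.c0 1 μ ^ d))) * B6.c0 1 μ ^ d) *
            B6.c0 1 μ ^ d)⁻¹) * B6.c0 1 μ ^ d)
        T SX A D ρ' ∧
      ∀ ω, DomBy (toB6 (torusGeom N 0 0 0) 0 True) (D ω) := by
  have hd0 : (0 : ℝ) < d := by exact_mod_cast Nat.pos_of_ne_zero (NeZero.ne d)
  have hM0 : (0 : ℝ) < M₀ := by exact_mod_cast hM₀
  have hM0' : (0 : ℝ) < (M₀ : ℝ) / (4 * d) := by positivity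
  have hcmax : 0 ≤ cmax := le_trans (le_trans hcmin.le (hc (ctrU N M₀ (fun _ => ⟨0, B5TorusCover.one_le_nC _ _⟩),
    ⟨0, Nat.pos_of_ne_zero (NeZero.ne d)⟩))) (hc' _)
  have hwmax : 0 ≤ wmax := (abs_nonneg _).trans (hw' 0 (ctrU N M₀ fun _ => ⟨0, B5TorusCover.one_le_nC _ _⟩))
  have hW : ∀ (l : Fin (k + 1)) (x : UT N), |w l (towerBlk (torusTower hM hdiv) (l : ℕ) x)| ≤ wmax := fun l x => hw' l _
  set ρd := domRadius d M k M₀ with hρd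
  have hρd0 : 0 ≤ ρd := domRadius_nonneg d M k M₀
  set L := skel hM hdiv c Rm k w a M₀ E d₀ N' with hL
  set K' : Matrix (UT N × Cp) (UT N × Cp) ℂ := cmat (towerOpT hM hdiv c Rm k w a) - 1 with hK'
  -- (a) the letters of K′: entry bound, block bound, range
  have hΛ := l2Bound_towerOp_torus hM hdiv c hcmax hc' Rm hRm k (W := fun l x => w l (towerBlk (torusTower hM hdiv) (l : ℕ) x))
    hwmax hW ha
  have hΛ0 : 0 ≤ towerLambda d M cmax wmax k a := by
    unfold towerLambda
    exact add_nonneg (by positivity) (Finset.sum_nonneg fun l _ => mul_nonneg (ha l) (by positivity))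
  have hKentry : ∀ p q, ‖K' p q‖ ≤ towerLambda d M cmax wmax k a + 1 := by
    intro p q
    rw [hK', Matrix.sub_apply]
    refine (norm_sub_le _ _).trans (add_le_add ?_ ?_)
    · simpa [towerOpT] using norm_cmat_le_of_l2Bound hΛ p q
    · rw [Matrix.one_apply]; split_ifs <;> simp
  have hKbd : ∀ y y', blockNorm (Prod.fst : UT N × Cp → UT N) Prod.fst K' y y' ≤
      Fintype.card Cp * (towerLambda d M cmax wmax k a + 1) :=
    fun y y' => blockNorm_le_of_rowMass_le _ _ K' y y' (by positivity) fun p _ => rowMass_fst_le hKentry p y'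
  have hKrange : ∀ p q : UT N × Cp, K' p q ≠ 0 → dTorus N Cp p q ≤ rangeTower d M k := by
    intro p q hne
    rw [dTorus_apply]
    by_contra hfar
    push Not at hfar
    apply hne
    rw [hK', Matrix.sub_apply, cmat_apply]
    have h0 : towerOpT hM hdiv c Rm k w a (Pi.single q 1) p = 0 := by
      simpa [towerOpT] using towerOp_single_eq_zero_of_far hM hdiv c Rm k
        (fun l x => w l (towerBlk (torusTower hM hdiv) (l : ℕ) x)) a p q 1 hfar
    have hpq : p ≠ q := fun h => by
      rw [h, dist_self] at hfar; exact absurd hfar (not_lt.2 (le_trans zero_le_one (one_le_rangeTower d M k)))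
    rw [h0, Matrix.one_apply_ne hpq]; simp
  -- (b) the letters of the local inverses: block bound from the WRS budget at rate 0
  have hθ := thetaD_pos d M cmin cmax wmax k ha hamin hwmin
  have hLbd : ∀ z y y', blockNorm (Prod.fst : UT N × Cp → UT N) Prod.fst (LTorus hM hdiv c Rm k w a M₀ z) y y' ≤
      localConst d M amin wmin cmin cmax wmax k a (Fintype.card Cp) 0 := by
    intro z y y'
    have hW0 := wrs_LTorus hM hdiv c hcmin hc hc' Rm hRm k w hw' ha hamin hwmin hcov hθ M₀ z
    refine blockNorm_le_of_rowMass_le _ _ _ y y' (localConst_nonneg d M cmin cmax wmax k a _ hθ.le hamin hwmin)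
      fun p _ => (rowMass_fst_le_rowSum _ p y').trans ?_
    have h := hW0 p
    simpa [wrs] using h
  -- (c) the domain letters
  have hdom_mem : ∀ z (y : UT N), dist (ctrU N M₀ z) y ≤ ρd → y ∈ L.dom z := fun z y hy => by
    show y ∈ Finset.univ.filter fun y : UT N => dist (ctrU N M₀ z) y ≤ domRadius d M k M₀
    exact Finset.mem_filter.2 ⟨Finset.mem_univ _, hy⟩
  have hdom_le : ∀ z (y : UT N), y ∈ L.dom z → dist (ctrU N M₀ z) y ≤ ρd := fun z y hy => (Finset.mem_filter.1 hy).2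
  have hE : ∀ z p, p ∈ ETorus hM hdiv k M₀ Cp z → (p : UT N × Cp).1 ∈ L.dom z := by
    intro z p hp
    refine hdom_mem z p.1 ?_
    have h1 := dist_lt_of_omegaBall_eq_one hM hdiv k M₀ z p.1 ((mem_ETorus hM hdiv k M₀ z p).1 hp)
    rw [dist_comm] at h1
    have := one_le_rangeTower d M k
    rw [hρd, domRadius]; linarith
  have hdomE : ∀ z (p : UT N × Cp), (∃ q ∈ ETorus hM hdiv k M₀ Cp z, dTorus N Cp p q ≤ rangeTower d M k) → p.1 ∈ L.dom z := by
    rintro z p ⟨q, hq, hpq⟩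
    refine hdom_mem z p.1 ?_
    have h1 := dist_lt_of_omegaBall_eq_one hM hdiv k M₀ z q.1 ((mem_ETorus hM hdiv k M₀ z q).1 hq)
    rw [dTorus_apply, dist_comm] at hpq
    rw [dist_comm] at h1
    calc dist (ctrU N M₀ z) p.1 ≤ dist (ctrU N M₀ z) q.1 + dist q.1 p.1 := dist_triangle _ _ _
      _ ≤ ρd := by rw [hρd, domRadius]; linarith
  have hdiam : ∀ z, ∀ y ∈ L.dom z, ∀ y' ∈ L.dom z, tdist1 N y y' ≤ d * (2 * ρd) := by
    intro z y hy y' hy'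
    refine (tdist1_le_mul_dist y y').trans (mul_le_mul_of_nonneg_left ?_ hd0.le)
    calc dist y y' ≤ dist y (ctrU N M₀ z) + dist (ctrU N M₀ z) y' := dist_triangle _ _ _
      _ ≤ ρd + ρd := add_le_add (by rw [dist_comm]; exact hdom_le z y hy) (hdom_le z y' hy')
      _ = 2 * ρd := by ring
  have hcard : ∀ z, (L.dom z).card ≤ ⌈(2 * ρd + 1) ^ d⌉₊ := by
    intro z
    have h := card_ball_le (N := N) (ctrU N M₀ z) hρd0
    exact_mod_cast (show ((L.dom z).card : ℝ) ≤ ⌈(2 * ρd + 1) ^ d⌉₊ from h.trans (Nat.le_ceil _))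
  have hmult : ∀ y : UT N, (Finset.univ.filter fun z : Ctr N M₀ => L.anchor z = y).card ≤ 3 ^ d := by
    intro y
    have h := hnu_holds (N := N) hM₀ (cbar := 0) le_rfl y
    have hsub : (Finset.univ.filter fun z : Ctr N M₀ => L.anchor z = y) ⊆
        Finset.univ.filter fun z : Ctr N M₀ => dist y (ctrU N M₀ z) ≤ 0 * M₀ := by
      intro z hz
      have e : ctrU N M₀ z = y := (Finset.mem_filter.1 hz).2
      exact Finset.mem_filter.2 ⟨Finset.mem_univ _, by rw [e, dist_self, zero_mul]⟩
    have h3 : ((2 * (0 : ℝ) + 3) ^ d) = ((3 ^ d : ℕ) : ℝ) := by push_cast; ring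
    exact_mod_cast (show ((Finset.univ.filter fun z : Ctr N M₀ => L.anchor z = y).card : ℝ) ≤ ((3 ^ d : ℕ) : ℝ) from
      (by exact_mod_cast Finset.card_le_card hsub : ((Finset.univ.filter fun z : Ctr N M₀ => L.anchor z = y).card : ℝ) ≤
        ((Finset.univ.filter fun z : Ctr N M₀ => dist y (ctrU N M₀ z) ≤ 0 * M₀).card : ℝ)).trans (h.trans (le_of_eq h3)))
  -- (d) assemble
  exact blockWalkExpansion_parametrix_lipschitz (L := L) (h := hTorus N Cp M₀) (Es := ETorus hM hdiv k M₀ Cp)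
    (K' := fun _ : E => K') (ds := dTorus N Cp) (c := c₀) (cubn := Prod.fst) (X := ∅) (R := R)
    (CL := localConst d M amin wmin cmin cmax wmax k a (Fintype.card Cp) 0)
    (CK := Fintype.card Cp * (towerLambda d M cmax wmax k a + 1)) (M := (M₀ : ℝ) / (4 * d)) (r₁ := rangeTower d M k)
    (r := d * (2 * ρd)) (mJ := 0) (nD := 3 ^ d) (nC := ⌈(2 * ρd + 1) ^ d⌉₊)
    (fun z => hdom_mem z _ (by rw [show L.anchor z = ctrU N M₀ z from rfl, dist_self]; exact hρd0)) hdiam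
    (fun z => by show (∅ : Finset (TPt d₀ N')).card ≤ 0; simp) (fun z hz => by simp [show L.J z = ∅ from rfl] at hz) hmult
    (fun z p hp => hTorus_supp hM hdiv k hM₀ z p hp) (fun z p => hTorus_abs M₀ z p) hE
    (fun z i j => differentiableOn_const _) (fun z u _ y y' => hLbd z y y')
    (localConst_nonneg d M cmin cmax wmax k a _ hθ.le hamin hwmin)
    (fun i j => differentiableOn_const _) (fun u _ y y' => hKbd y y') (mul_nonneg (Nat.cast_nonneg _) (by linarith [hΛ0])) hM0'
    (le_trans zero_le_one (one_le_rangeTower d M k)) (fun p q => by rw [dTorus_apply, dTorus_apply, dist_comm])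
    (fun p => by rw [dTorus_apply, dist_self]; exact le_trans zero_le_one (one_le_rangeTower d M k))
    (fun z p q => hTorus_lip hM₀ z p q) (fun _ p q h => hKrange p q h) hdomE hcard
    hκ₁ hμ.le hμε hμκ hwin (pow_nonneg (le_trans zero_le_one (B6Lemma21Arith.one_le_c0 (by simpa using hμ))) d)
    (rowSum_torus N hμ) hq

end Summit.QuantumFields.BalabanUV.Gaps.D4WalkBlockCovariantTower

end
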